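import Mathlib
import Summits.Parity.GeneralizedHardyLittlewood.Theorems.PrimeGapTorusCapPart3
import HarnessLib

/-!
# Prime-gap limit points, the torus cap (cell parity-ideate, p4 ROUND-12) — part 4/8 (`runOne_isArc_prime` … `coeff_hQ_eq`)

Source: `HOME/parity-ideate-p4/round12/Sketch16.lean` (sha16 e5770481db81479a, 7 278 lines, farm rc 0 / 0 sorry /
axioms std-3; namespace `ParityIdeateP4R8`), cut by parity-ideate-lit g32 (`ports/toruscap/build_toruscap.py`) to the
dependency cone (143 declarations) of the eight headline declarations `torusCap_iff`, `torusCapBrauer_iff`,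
`torusCap_half`, `cb1_holds`, `conjHalfStrict_holds`, `NearAP.delannoyNonVanishing_holds`, `capGivesCoverage`,
`residueCoverage_half_of_literature`, in a chain of 8 files of ≤ 400 lines (Theorems-side lint); statements byte-identical
to the source except: `NearAP.P0/P1/P2` are `abbrev` (source: `def` + three `Decidable` instances, dropped per the typing
lint), examples and `decide` rungs outside the cone dropped, namespace `ParityIdeateP4R8` ↦ `Summit.Parity.GeneralizedHardyLittlewood.Theorems.PrimeGapTorusCap`.
Non-Mathlib inputs: `Literature.Combinatorics.Additive.ErdosHeilbronn` (combinatorial Nullstellensatz),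
`Literature.NumberTheory.Sieve.PrimeGapLimitPoints` (`primeGapLimitSet`, `HasPointProperty`, the NAMED fact
`Merikoski2020_theorem1`, used hypothesis-style, never asserted).  No `sorry`, no new axioms, no `instance`, no notation.
Cell-original mathematics (FRONTIER formalisation; nothing here bears on the parity problem beyond the typed statements):
CONJECTURE C of the cell = every measurable `perℤ`-periodic four-point-free `U ⊆ ℝ` has `μ(U ∩ [0,per)) ≤ per/2`,
sharp (mid arc); pay-off: residues of the prime-gap limit-point set `𝓛` modulo `λ` cover ≥ half of `[0, λ)` for every
`λ > 0`, given Merikoski's four-point theorem.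
-/

namespace Summit.Parity.GeneralizedHardyLittlewood.Theorems.PrimeGapTorusCap.NearAP
variable {N : ℕ}
section runone
variable {p : ℕ} [hp : Fact p.Prime]

/-- (cell parity-ideate p4, Sketch16 — helper; statement verbatim) -/
theorem runOne_isArc_prime (S : Finset (ZMod p)) (hne : S.Nonempty) (h2 : 2 * S.card ≤ p) (hρ : runCount S ≤ 1) :
    ∃ c : ZMod p, S = translateSet c (arc p S.card) := by
  have hp' : p.Prime := hp.out
  have hp2 : 2 ≤ p := hp'.two_le
  -- (1) there is a run start
  have hstart : (S.filter fun s => s - 1 ∉ S).Nonempty := by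
    by_contra h
    rw [Finset.not_nonempty_iff_eq_empty, Finset.filter_eq_empty_iff] at h
    have hcl : ∀ s ∈ S, s - 1 ∈ S := fun s hs => by simpa using h hs
    have hu := eq_univ_of_pred_closed S hne hcl
    have : S.card = p := by rw [hu, Finset.card_univ, ZMod.card]
    omega
  -- (2) it is unique: the filter is a singleton {c}
  have hcard1 : (S.filter fun s => s - 1 ∉ S).card = 1 := by
    have := Finset.card_pos.mpr hstart
    unfold runCount at hρ; omega
  obtain ⟨c, hc⟩ := Finset.card_eq_one.mp hcard1
  have hcS : c ∈ S := by
    have : c ∈ S.filter fun s => s - 1 ∉ S := by rw [hc]; simp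
    exact (Finset.mem_filter.mp this).1
  have hpred : ∀ s ∈ S, s ≠ c → s - 1 ∈ S := by
    intro s hs hsc
    by_contra hn
    have : s ∈ S.filter fun s => s - 1 ∉ S := Finset.mem_filter.mpr ⟨hs, hn⟩
    rw [hc, Finset.mem_singleton] at this
    exact hsc this
  -- (3) walking down from any s ∈ S stays in S until c
  have walk : ∀ n : ℕ, ∀ s ∈ S, (∀ i < n, s - (i : ZMod p) ≠ c) → s - (n : ZMod p) ∈ S := by
    intro n
    induction n with
    | zero => intro s hs _; simpa using hs
    | succ n ih =>
      intro s hs hi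
      have h1 : s - (n : ZMod p) ∈ S := ih s hs (fun i hi' => hi i (by omega))
      have h2 : s - (n : ZMod p) ≠ c := hi n (by omega)
      have := hpred _ h1 h2
      simpa [sub_sub, Nat.cast_succ] using this
  -- (4) every s ∈ S is c + j with j < |S|
  set k := S.card with hk
  have hkp : k ≤ p := by omega
  have hmem : ∀ s ∈ S, ∃ j : ℕ, j < k ∧ s = (j : ZMod p) + c := by
    intro s hs
    set j := (s - c).val with hj
    have hjp : j < p := ZMod.val_lt _
    have hsj : s = (j : ZMod p) + c := by rw [hj, ZMod.natCast_zmod_val]; ring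
    refine ⟨j, ?_, hsj⟩
    -- the j+1 elements s - i, i ≤ j, lie in S and are distinct
    have hne_c : ∀ i < j, s - (i : ZMod p) ≠ c := by
      intro i hi heq
      have : ((i : ZMod p)) = (j : ZMod p) := by
        have : (i : ZMod p) = s - c := by rw [← heq]; ring
        rw [this, hsj]; ring
      have := natCast_inj_of_lt_pr (by omega) hjp this
      omega
    have hsub : (Finset.range (j + 1)).image (fun i : ℕ => s - (i : ZMod p)) ⊆ S := by
      intro x hx
      obtain ⟨i, hi, rfl⟩ := Finset.mem_image.mp hx
      have hi' : i ≤ j := by simpa [Finset.mem_range, Nat.lt_succ_iff] using hi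
      exact walk i s hs (fun i' hi'' => hne_c i' (by omega))
    have hinj : Set.InjOn (fun i : ℕ => s - (i : ZMod p)) (Finset.range (j + 1) : Set ℕ) := by
      intro i hi i' hi' h
      have hi1 : i < j + 1 := by simpa using hi
      have hi2 : i' < j + 1 := by simpa using hi'
      have : (i : ZMod p) = (i' : ZMod p) := by
        have := h; simp only at this; exact sub_right_injective this
      by_cases hjp1 : j + 1 ≤ p
      · exact natCast_inj_of_lt_pr (by omega) (by omega) this
      · -- j = p - 1 is impossible? it is possible only if j+1 = p; then still i, i' < p
        exact natCast_inj_of_lt_pr (by omega) (by omega) this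
    have hcardimg : ((Finset.range (j + 1)).image (fun i : ℕ => s - (i : ZMod p))).card = j + 1 := by
      rw [Finset.card_image_of_injOn hinj, Finset.card_range]
    have := Finset.card_le_card hsub
    omega
  -- (5) conclude
  refine ⟨c, ?_⟩
  have hsub : S ⊆ translateSet c (arc p k) := by
    intro s hs
    obtain ⟨j, hj, rfl⟩ := hmem s hs
    unfold translateSet arc
    exact Finset.mem_image.mpr ⟨(j : ZMod p), Finset.mem_image.mpr ⟨j, Finset.mem_range.mpr hj, rfl⟩, rfl⟩
  have hle : (translateSet c (arc p k)).card ≤ k := by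
    unfold translateSet arc
    calc ((Finset.image (fun i : ℕ => (i : ZMod p)) (Finset.range k)).image (fun x => x + c)).card
        ≤ (Finset.image (fun i : ℕ => (i : ZMod p)) (Finset.range k)).card := Finset.card_image_le
      _ ≤ (Finset.range k).card := Finset.card_image_le
      _ = k := Finset.card_range k
  exact Finset.eq_of_subset_of_card_le hsub (by omega)

end runone
/-- `RunOneIsArc` restricted to primes (all that the top-slice theorems use). -/
def RunOneIsArcPrime : Prop :=
  ∀ p : ℕ, p.Prime → ∀ S : Finset (ZMod p), S.Nonempty → 2 * S.card ≤ p → runCount S ≤ 1 →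
    ∃ c : ZMod p, S = translateSet c (arc p S.card)

/-- (cell parity-ideate p4, Sketch16 — helper; statement verbatim) -/
theorem runOneIsArcPrime_holds : RunOneIsArcPrime := by
  intro p hp S hne h2 hρ
  haveI : Fact p.Prime := ⟨hp⟩
  exact runOne_isArc_prime S hne h2 hρ

/-! ## Arcs have `|D₃⁺| ≥ |S|` — proved (the lower half of `ArcExact`, which is all the top-slice theorems use). -/

section arclower
variable {p : ℕ} [NeZero p]
/-- the `m`-th exhibited step: `m/2` for even `m`, `-( (m+1)/2 )` for odd `m`. -/
private def stepOf (p : ℕ) (m : ℕ) : ZMod p := if m % 2 = 0 then ((m / 2 : ℕ) : ZMod p) else -(((m + 1) / 2 : ℕ) : ZMod p)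

omit [NeZero p] in
/-- (cell parity-ideate p4, Sketch16 — helper; statement verbatim) -/
private lemma natCast_inj_of_lt' {i j : ℕ} (hi : i < p) (hj : j < p) (h : (i : ZMod p) = (j : ZMod p)) : i = j := by
  have h1 : ((i : ZMod p)).val = i := by rw [ZMod.val_natCast]; exact Nat.mod_eq_of_lt hi
  have h2 : ((j : ZMod p)).val = j := by rw [ZMod.val_natCast]; exact Nat.mod_eq_of_lt hj
  rw [← h1, ← h2, h]

omit [NeZero p] in
/-- (cell parity-ideate p4, Sketch16 — helper; statement verbatim) -/
private lemma natCast_ne_neg_natCast {a b : ℕ} (hb : 0 < b) (hab : a + b < p) : (a : ZMod p) ≠ -(b : ZMod p) := by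
  intro h
  have h0 : ((a + b : ℕ) : ZMod p) = 0 := by push_cast; rw [h]; ring
  rw [ZMod.natCast_eq_zero_iff] at h0
  have := Nat.le_of_dvd (by omega) h0
  omega

omit [NeZero p] in
/-- (cell parity-ideate p4, Sketch16 — helper; statement verbatim) -/
private lemma mem_tarc {c : ZMod p} {k i : ℕ} (hi : i < k) : ((i : ℕ) : ZMod p) + c ∈ translateSet c (arc p k) := by
  unfold translateSet arc
  exact Finset.mem_image.mpr ⟨(i : ZMod p), Finset.mem_image.mpr ⟨i, Finset.mem_range.mpr hi, rfl⟩, rfl⟩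

/-- (cell parity-ideate p4, Sketch16 — helper; statement verbatim) -/
theorem arc_lower (c : ZMod p) (k : ℕ) (hk : 1 ≤ k) (h2 : 2 * k ≤ p) :
    k ≤ d3plusCard (translateSet c (arc p k)) := by
  set S := translateSet c (arc p k) with hS
  -- every exhibited step lies in D₃⁺
  have hmem : ∀ m < k, stepOf p m ∈ (Finset.univ.filter fun j => P0 S j ∨ P1 S j ∨ P2 S j) := by
    intro m hm
    rw [Finset.mem_filter]
    refine ⟨Finset.mem_univ _, ?_⟩
    unfold stepOf
    by_cases he : m % 2 = 0
    · rw [if_pos he]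
      left
      refine ⟨((0 : ℕ) : ZMod p) + c, mem_tarc (by omega), ?_, ?_⟩
      · have : ((0 : ℕ) : ZMod p) + c + ((m / 2 : ℕ) : ZMod p) = ((m / 2 : ℕ) : ZMod p) + c := by push_cast; ring
        rw [this]; exact mem_tarc (by omega)
      · have h2m : 2 * (m / 2) = m := by omega
        have : ((0 : ℕ) : ZMod p) + c + 2 * ((m / 2 : ℕ) : ZMod p) = ((m : ℕ) : ZMod p) + c := by
          have : ((m : ℕ) : ZMod p) = ((2 * (m / 2) : ℕ) : ZMod p) := by rw [h2m]
          rw [this]; push_cast; ring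
        rw [this]; exact mem_tarc hm
    · rw [if_neg he]
      right; left
      refine ⟨((m : ℕ) : ZMod p) + c, mem_tarc hm, ?_, ?_⟩
      · have hle : (m + 1) / 2 ≤ m := by omega
        have : ((m : ℕ) : ZMod p) + c + -(((m + 1) / 2 : ℕ) : ZMod p) = ((m - (m + 1) / 2 : ℕ) : ZMod p) + c := by
          rw [Nat.cast_sub hle]; ring
        rw [this]; exact mem_tarc (by omega)
      · have h2m : 2 * ((m + 1) / 2) = m + 1 := by omega
        have : ((m : ℕ) : ZMod p) + c + 2 * -(((m + 1) / 2 : ℕ) : ZMod p) + 1 = ((0 : ℕ) : ZMod p) + c := by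
          have h' : (2 : ZMod p) * (((m + 1) / 2 : ℕ) : ZMod p) = ((2 * ((m + 1) / 2) : ℕ) : ZMod p) := by push_cast; ring
          have h'' : ((2 * ((m + 1) / 2) : ℕ) : ZMod p) = ((m + 1 : ℕ) : ZMod p) := by rw [h2m]
          calc ((m : ℕ) : ZMod p) + c + 2 * -(((m + 1) / 2 : ℕ) : ZMod p) + 1
              = ((m : ℕ) : ZMod p) + c - ((2 : ZMod p) * (((m + 1) / 2 : ℕ) : ZMod p)) + 1 := by ring
            _ = ((m : ℕ) : ZMod p) + c - ((m + 1 : ℕ) : ZMod p) + 1 := by rw [h', h'']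
            _ = ((0 : ℕ) : ZMod p) + c := by push_cast; ring
        rw [this]; exact mem_tarc (by omega)
  -- the exhibited steps are pairwise distinct
  have hinj : Set.InjOn (stepOf p) (Finset.range k : Set ℕ) := by
    intro m hm m' hm' h
    have hm1 : m < k := by simpa using hm
    have hm2 : m' < k := by simpa using hm'
    unfold stepOf at h
    by_cases he : m % 2 = 0 <;> by_cases he' : m' % 2 = 0
    · rw [if_pos he, if_pos he'] at h
      have := natCast_inj_of_lt' (p := p) (by omega) (by omega) h
      omega
    · rw [if_pos he, if_neg he'] at h
      exact absurd h (natCast_ne_neg_natCast (by omega) (by omega))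
    · rw [if_neg he, if_pos he'] at h
      exact absurd h.symm (natCast_ne_neg_natCast (by omega) (by omega))
    · rw [if_neg he, if_neg he'] at h
      have := natCast_inj_of_lt' (p := p) (by omega) (by omega) (neg_inj.mp h)
      omega
  have hsub : (Finset.range k).image (stepOf p) ⊆ Finset.univ.filter fun j => P0 S j ∨ P1 S j ∨ P2 S j := by
    intro x hx
    obtain ⟨m, hm, rfl⟩ := Finset.mem_image.mp hx
    exact hmem m (Finset.mem_range.mp hm)
  have := Finset.card_le_card hsub
  rw [Finset.card_image_of_injOn hinj, Finset.card_range] at this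
  unfold d3plusCard
  exact this

end arclower
/-- **Top slice at every prime from R★ and Q alone** (the arc and one-run hypotheses are now theorems). -/
theorem topSlice_all_of'' (hR : PolyRungStar) (hQ : DelannoyNonVanishing)
    (p : ℕ) (hp : p.Prime) (h7 : 7 ≤ p) (S : Finset (ZMod p)) (hk : 2 * S.card + 1 = p) :
    S.card ≤ @d3plusCard p ⟨hp.ne_zero⟩ S := by
  haveI : NeZero p := ⟨hp.ne_zero⟩
  have hne : S.Nonempty := by rw [← Finset.card_pos]; omega
  by_cases hρ : runCount S ≤ 1
  · obtain ⟨c, hc⟩ := runOneIsArcPrime_holds p hp S hne (by omega) hρ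
    have := arc_lower c S.card (by omega) (by omega)
    rw [← hc] at this
    exact this
  · push Not at hρ
    have hD := hQ p hp (by omega)
    have hk' : (p - 3) / 2 = S.card - 1 := by omega
    rw [hk'] at hD
    exact hR p hp (by omega) S (by omega) (by omega) hD

/-! ## The combinatorial half of R★'s formalisation: admissible pairs give steps.
For `a ∈ S`, `b ∈ S ∪ (S-1)` with midpoint `m ∈ S` (`m + m = a + b`), the step `j := m - a` (so `2j = b - a`) lies in `D₃⁺ S`
(pattern `P0` if `b ∈ S`, `P1` if `b + 1 ∈ S`).  The analytic half (ANR with `h = Π_{c∉S}((y-x)/2 - c)·y^d` and the Delannoy coefficient) is ROUND-12 (β). -/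

/-- (cell parity-ideate p4, Sketch16 — helper; statement verbatim) -/
theorem step_of_admissible_pair {N : ℕ} (S : Finset (ZMod N)) {a m b : ZMod N}
    (ha : a ∈ S) (hm : m ∈ S) (hb : b ∈ S ∨ b + 1 ∈ S) (h2 : m + m = a + b) :
    (P0 S (m - a) ∨ P1 S (m - a) ∨ P2 S (m - a)) ∧ (m - a) + (m - a) = b - a := by
  have hb' : a + 2 * (m - a) = b := by
    have : a + 2 * (m - a) = (m + m) - a := by ring
    rw [this, h2]; ring
  refine ⟨?_, by rw [← hb']; ring⟩
  rcases hb with hb | hb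
  · left
    exact ⟨a, ha, by simpa using hm, by rw [hb']; exact hb⟩
  · right; left
    exact ⟨a, ha, by simpa using hm, by rw [hb']; exact hb⟩

/-- Hence, at an odd modulus, `|{(b - a) : admissible}| ≤ |D₃⁺ S|` will follow by the injectivity of doubling; recorded as the target shape. -/
theorem steps_cover_admissible {N : ℕ} [NeZero N] (S : Finset (ZMod N)) {a m b : ZMod N}
    (ha : a ∈ S) (hm : m ∈ S) (hb : b ∈ S ∨ b + 1 ∈ S) (h2 : m + m = a + b) :
    ∃ j ∈ (Finset.univ.filter fun j => P0 S j ∨ P1 S j ∨ P2 S j), j + j = b - a := by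
  obtain ⟨h, hj⟩ := step_of_admissible_pair S ha hm hb h2
  exact ⟨m - a, Finset.mem_filter.mpr ⟨Finset.mem_univ _, h⟩, hj⟩

/-! ## (β2, arithmetic part) The ANR certificate coefficient is the central Delannoy number mod `p`:
`Σ_{i<k} (-1)^i C(k-1,i) C(p-k,i) = D_{k-1}` in `ZMod p` (upper negation `C(p-k,i) ≡ (-1)^i C(k-1+i,i)`), for `1 ≤ k`, `2k ≤ p + 1`. -/

section coeff
variable {p : ℕ} [hp : Fact p.Prime]
/-- (cell parity-ideate p4, Sketch16 — helper; statement verbatim) -/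
theorem choose_upper_neg (k : ℕ) (hk : 1 ≤ k) :
    ∀ i : ℕ, k + i ≤ p → (((p - k).choose i : ℕ) : ZMod p) = (-1) ^ i * (((k - 1 + i).choose i : ℕ) : ZMod p) := by
  intro i
  induction i with
  | zero => intro _; simp
  | succ i ih =>
    intro hki
    have IH := ih (by omega)
    have hA : (((p - k).choose (i + 1) : ℕ) : ZMod p) * ((i + 1 : ℕ) : ZMod p)
        = (((p - k).choose i : ℕ) : ZMod p) * ((p - k - i : ℕ) : ZMod p) := by
      have h0 := congrArg (fun n : ℕ => (n : ZMod p)) (Nat.choose_succ_right_eq (p - k) i)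
      simpa only [Nat.cast_mul] using h0
    have hcast : ((p - k - i : ℕ) : ZMod p) = -(((k : ℕ) : ZMod p) + ((i : ℕ) : ZMod p)) := by
      rw [Nat.cast_sub (by omega : i ≤ p - k), Nat.cast_sub (by omega : k ≤ p), ZMod.natCast_self]; ring
    have hB : ((k + i : ℕ) : ZMod p) * (((k - 1 + i).choose i : ℕ) : ZMod p)
        = (((k + i).choose (i + 1) : ℕ) : ZMod p) * ((i + 1 : ℕ) : ZMod p) := by
      have e : k - 1 + i + 1 = k + i := by omega
      have h0 := Nat.add_one_mul_choose_eq (k - 1 + i) i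
      rw [e] at h0
      have h1 := congrArg (fun n : ℕ => (n : ZMod p)) h0
      simpa only [Nat.cast_mul] using h1
    have hi1 : ((i + 1 : ℕ) : ZMod p) ≠ 0 := by
      rw [Ne, ZMod.natCast_eq_zero_iff]
      intro h; have := Nat.le_of_dvd (by omega) h; omega
    have e2 : k - 1 + (i + 1) = k + i := by omega
    rw [e2]
    apply mul_right_cancel₀ hi1
    calc (((p - k).choose (i + 1) : ℕ) : ZMod p) * ((i + 1 : ℕ) : ZMod p)
        = (((p - k).choose i : ℕ) : ZMod p) * ((p - k - i : ℕ) : ZMod p) := hA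
      _ = ((-1) ^ i * (((k - 1 + i).choose i : ℕ) : ZMod p)) * -(((k : ℕ) : ZMod p) + ((i : ℕ) : ZMod p)) := by rw [IH, hcast]
      _ = (-1) ^ (i + 1) * (((k + i : ℕ) : ZMod p) * (((k - 1 + i).choose i : ℕ) : ZMod p)) := by push_cast; ring
      _ = (-1) ^ (i + 1) * (((k + i).choose (i + 1) : ℕ) : ZMod p) * ((i + 1 : ℕ) : ZMod p) := by rw [hB]; ring

/-- The certificate coefficient of R★ equals `D_{k-1}` in `ZMod p`. -/
theorem anr_coeff_eq_delannoy (k : ℕ) (hk : 1 ≤ k) (h2 : 2 * k ≤ p + 1) :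
    (∑ i ∈ Finset.range k, (-1 : ZMod p) ^ i * (((k - 1).choose i : ℕ) : ZMod p) * (((p - k).choose i : ℕ) : ZMod p))
      = ((delannoyC (k - 1) : ℕ) : ZMod p) := by
  unfold delannoyC
  have e : k - 1 + 1 = k := by omega
  rw [e]
  push_cast
  refine Finset.sum_congr rfl fun i hi => ?_
  have hik : i < k := Finset.mem_range.mp hi
  rw [choose_upper_neg k hk i (by omega), binomF_eq_choose, binomF_eq_choose]
  have : ((-1 : ZMod p)) ^ i * (-1) ^ i = 1 := by rw [← mul_pow]; norm_num
  calc (-1 : ZMod p) ^ i * (((k - 1).choose i : ℕ) : ZMod p) * ((-1) ^ i * (((k - 1 + i).choose i : ℕ) : ZMod p))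
      = ((-1 : ZMod p) ^ i * (-1) ^ i) * ((((k - 1).choose i : ℕ) : ZMod p) * (((k - 1 + i).choose i : ℕ) : ZMod p)) := by ring
    _ = (((k - 1).choose i : ℕ) : ZMod p) * (((k - 1 + i).choose i : ℕ) : ZMod p) := by rw [this, one_mul]

end coeff
/-! ## (β3) Any set of admissible differences is at most `|D₃⁺ S|` in size (via the image of `j ↦ j + j`; no injectivity needed). -/

/-- (cell parity-ideate p4, Sketch16 — helper; statement verbatim) -/
theorem card_admissible_le {N : ℕ} [NeZero N] (S : Finset (ZMod N)) (E : Finset (ZMod N))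
    (hE : ∀ e ∈ E, ∃ a m b : ZMod N, a ∈ S ∧ m ∈ S ∧ (b ∈ S ∨ b + 1 ∈ S) ∧ m + m = a + b ∧ e = b - a) :
    E.card ≤ d3plusCard S := by
  have hsub : E ⊆ (Finset.univ.filter fun j => P0 S j ∨ P1 S j ∨ P2 S j).image (fun j => j + j) := by
    intro e he
    obtain ⟨a, m, b, ha, hm, hb, h2, rfl⟩ := hE e he
    obtain ⟨j, hj, hjj⟩ := steps_cover_admissible S ha hm hb h2
    exact Finset.mem_image.mpr ⟨j, hj, hjj⟩
  unfold d3plusCard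
  exact (Finset.card_le_card hsub).trans Finset.card_image_le

/-! ## (β1, key step) Top-degree coefficients of `h · (x+y)^r · ∏_{c∈C}(x+y-c)` are those of `h · (x+y)^{r+|C|}`
(general-`h` version of `Literature.Combinatorics.Additive.ErdosHeilbronn.coeff_Q_eq`, same proof). -/

section anrprep
open MvPolynomial Literature.Combinatorics.Additive Literature.Combinatorics.Additive.ErdosHeilbronn
variable {R : Type*} [CommRing R] [Nontrivial R] [DecidableEq R]
/-- (cell parity-ideate p4, Sketch16 — helper; statement verbatim) -/
theorem coeff_hQ_eq (h : MvPolynomial (Fin 2) R) (C : Finset R) :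
    ∀ (r : ℕ) (d : Fin 2 →₀ ℕ), h.totalDegree + r + C.card ≤ d.degree →
      coeff d (h * ((L : MvPolynomial (Fin 2) R) ^ r * ∏ c ∈ C, (L - MvPolynomial.C c))) =
        coeff d (h * (L : MvPolynomial (Fin 2) R) ^ (r + C.card)) := by
  induction C using Finset.induction_on with
  | empty => intro r d _; simp
  | insert c C hc ih =>
    intro r d hd
    rw [Finset.prod_insert hc, Finset.card_insert_of_notMem hc] at *
    have hsplit : h * ((L : MvPolynomial (Fin 2) R) ^ r * ((L - MvPolynomial.C c) * ∏ x ∈ C, (L - MvPolynomial.C x))) =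
        h * (L ^ (r + 1) * ∏ x ∈ C, (L - MvPolynomial.C x)) -
          MvPolynomial.C c * (h * (L ^ r * ∏ x ∈ C, (L - MvPolynomial.C x))) := by
      ring
    rw [hsplit, coeff_sub, coeff_C_mul, ih (r + 1) d (by omega)]
    have hlow : coeff d (h * ((L : MvPolynomial (Fin 2) R) ^ r * ∏ x ∈ C, (L - MvPolynomial.C x))) = 0 := by
      apply coeff_eq_zero_of_totalDegree_lt
      rw [← Finsupp.degree_apply]
      have h1 := totalDegree_Q_le (R := R) C r
      have h2 := totalDegree_mul h ((L : MvPolynomial (Fin 2) R) ^ r * ∏ x ∈ C, (L - MvPolynomial.C x))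
      omega
    rw [hlow, mul_zero, sub_zero, show r + (C.card + 1) = r + 1 + C.card by ring]

end anrprep
end Summit.Parity.GeneralizedHardyLittlewood.Theorems.PrimeGapTorusCap.NearAP
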